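import Summits.NavierStokesRegularity.FluidComputer.PalasekTowerGermHostCompanion

/-!
# The germ host, XX: EVERY AMPLIFIER, PLACED FAR ENOUGH, keeps a certified carrier in its slot

Cell `ns-blowup`, seat `ns-blowup-ecbridge-3` (g4); GROUP C «BRIDGE SUPPORT» of the route
`PalasekTowerBreakdown` (crux `EpisodeBaseG`, item stmt-NavierStokesRegularity-19179, R2 of record;
registered line `slot`, ONE stub over the STRICT slot `Germ.LevelZeroData`). Sequel of
`PalasekTowerGermHostCompanion` (XIX). LABEL: E–C typing (KERNEL bookkeeping; no definition). WHAT THIS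
IS NOT: not Navier–Stokes evidence — level-`0` bookkeeping of PRESCRIBED composite profiles at one
instant; nothing about any flow after `τ₀`, `FirstEpisodeD`, `RungG 1` or blow-up.

## What and why

XIX's companion rule asks a companion `U₂` to live outside `B̄(0, ρ₁ + d)` under an energy × `d⁻⁴`
budget. Here the companion is a TRANSLATE `x ↦ W (x − c)` of a fixed structure `W` (smooth, divergence
free, `tsupport W ⊆ B̄(0, R)`, everywhere slower than `Y₀` — the would-be amplifier, designed once at the
origin) and the budget is discharged by DISTANCE alone:

* §1 translates: support in `B̄(c, R)`, hence outside `B̄(0, ρ₁ + d)` once `ρ₁ + d + R < ‖c‖`;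
  smoothness, divergence-freeness, speed and ENERGY (`∫‖W(· − c)‖² = ∫‖W‖²`) are those of `W`;
* §2 **`LevelZeroData.add_translate`**: strict carrier with anchor values `≥ m` + `W(· − c)` with
  `1/N₀ ≤ d`, `ρ₁ + d + R < ‖c‖`, `(3/(2πd⁴)) Y₀ ∫‖W‖² < m` ⇒ STRICT filler of radius `‖c‖ + R`;
  `LevelZeroDataTol.add_translate` likewise with the tolerant budget;
* §3 **`LevelZeroData.exists_add_translate`**: for EVERY strict carrier and EVERY such `W` there is
  `r₀` with `LevelZeroData (U₁ + W(· − c)) (‖c‖ + R)` for all `‖c‖ ≥ r₀` — the registered stub's `∃ U`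
  contains «certified carrier + ANY amplifier far enough», with no number to compute about `W` but
  its speed bound (the carrier's `rate`, GermHost V, absorbs the energy at large distance);
  `LevelZeroDataWeak.exists_add_translate` gives the same into the tolerant slot at any push `c₄ > 0`.

References: S. Palasek, arXiv:2605.13827 §3.3 (host preparation before the first readout)
[cite: Palasek2026ElementaryModel, §3.3]; D. Gilbarg, N. S. Trudinger, *Elliptic PDE of Second Order*
(2001), Lemma 4.1 [cite: GilbargTrudinger2001, Lemma 4.1].
-/

noncomputable section

namespace Summit.NavierStokesRegularity.FluidComputer.PalasekTowerClayBridge.Germ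

open Set Function Filter Topology InnerProductSpace Metric MeasureTheory Real
open scoped Topology ContDiff RealInnerProductSpace

open Literature.Analysis.FluidPDE

/-! ## §1 Translates of a compactly supported structure -/

section Translate

variable {W : EuclideanSpace ℝ (Fin 3) → EuclideanSpace ℝ (Fin 3)} {R : ℝ} (c : EuclideanSpace ℝ (Fin 3))

/-- A translate of a smooth field is smooth. [folklore] -/
theorem contDiff_translate (hW : ContDiff ℝ ∞ W) : ContDiff ℝ ∞ fun x => W (x - c) :=
  hW.comp (contDiff_id.sub contDiff_const)

/-- The support of the translate `W(· − c)` lies in `B̄(c, R)` if `tsupport W ⊆ B̄(0, R)`: in norm form,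
`‖y − c‖ ≤ R` on it. [folklore] -/
theorem norm_sub_le_of_mem_tsupport_translate (hWsupp : tsupport W ⊆ closedBall 0 R)
    {y : EuclideanSpace ℝ (Fin 3)} (hy : y ∈ tsupport fun x => W (x - c)) : ‖y - c‖ ≤ R := by
  by_contra hlt
  rw [not_le] at hlt
  -- `W(· − c)` vanishes on the open set `{y' | R < ‖y' − c‖} ∋ y`
  have hopen : IsOpen {y' : EuclideanSpace ℝ (Fin 3) | R < ‖y' - c‖} :=
    isOpen_lt continuous_const (continuous_id.sub continuous_const).norm
  have hzero : (fun x => W (x - c)) =ᶠ[𝓝 y] 0 := by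
    filter_upwards [hopen.mem_nhds hlt] with y' hy'
    have : y' - c ∉ tsupport W := fun h =>
      absurd (mem_closedBall_zero_iff.1 (hWsupp h)) (not_le.2 hy')
    exact image_eq_zero_of_notMem_tsupport this
  exact (notMem_tsupport_iff_eventuallyEq.2 hzero) hy

/-- … hence in `B̄(0, ‖c‖ + R)`. [folklore] -/
theorem tsupport_translate_subset (hWsupp : tsupport W ⊆ closedBall 0 R) :
    (tsupport fun x => W (x - c)) ⊆ closedBall 0 (‖c‖ + R) := fun y hy => by
  have h1 := norm_sub_le_of_mem_tsupport_translate c hWsupp hy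
  have h2 : ‖y‖ ≤ ‖y - c‖ + ‖c‖ := norm_le_norm_sub_add y c
  exact mem_closedBall_zero_iff.2 (by linarith)

/-- … and outside `B̄(0, ρ₁ + d)` as soon as `ρ₁ + d + R < ‖c‖`. [folklore] -/
theorem far_of_translate (hWsupp : tsupport W ⊆ closedBall 0 R) {ρ₁ d : ℝ} (hc : ρ₁ + d + R < ‖c‖) :
    ∀ y ∈ tsupport (fun x => W (x - c)), ρ₁ + d < ‖y‖ := fun y hy => by
  have h1 := norm_sub_le_of_mem_tsupport_translate c hWsupp hy
  have h2 : ‖c‖ ≤ ‖c - y‖ + ‖y‖ := norm_le_norm_sub_add c y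
  rw [norm_sub_rev] at h2
  linarith

/-- A translate of a divergence-free smooth field is divergence free. [folklore] -/
theorem isDivFree_translate (hdiv : VectorCalculus.IsDivFree W) :
    VectorCalculus.IsDivFree fun x => W (x - c) := by
  intro x
  have e := hdiv (x - c)
  simp only [VectorCalculus.divergence] at e ⊢
  rw [fderiv_comp_sub]
  exact e

/-- The energy of a translate is the energy. [folklore] -/
theorem integral_norm_sq_translate : ∫ x, ‖W (x - c)‖ ^ 2 = ∫ x, ‖W x‖ ^ 2 :=
  integral_sub_right_eq_self (fun x => ‖W x‖ ^ 2) c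

end Translate

/-! ## §2 The companion rule for a translated amplifier -/

section Slots

variable {U₁ W : EuclideanSpace ℝ (Fin 3) → EuclideanSpace ℝ (Fin 3)} {ρ₁ R d : ℝ}
  {c : EuclideanSpace ℝ (Fin 3)}
  (hW : ContDiff ℝ ∞ W) (hdivW : VectorCalculus.IsDivFree W) (hWsupp : tsupport W ⊆ closedBall 0 R)
  (hWlt : ∀ x, ‖W x‖ < TowerRates.wide.Y 0) (hR : 0 ≤ R) (hdN : 1 / TowerRates.wide.N 0 ≤ d)
  (hc : ρ₁ + d + R < ‖c‖)

include hW hdivW hWsupp hWlt hR hdN hc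

/-- **STRICT SLOT, translated amplifier**: a strict carrier with anchor values `≥ m` on its argmax plus
`W(· − c)` (`R ≥ 0`) with `1/N₀ ≤ d`, `ρ₁ + d + R < ‖c‖` and `(3/(2πd⁴)) Y₀ ∫‖W‖² < m` is a STRICT
filler of radius `‖c‖ + R`. [cite: Palasek2026ElementaryModel, §3.3] -/
theorem LevelZeroData.add_translate (h₁ : LevelZeroData U₁ ρ₁) {m : ℝ}
    (hm : ∀ x, ‖U₁ x‖ = TowerRates.wide.Y 0 → m ≤ ⟪U₁ x, accel 1 U₁ x⟫)
    (hbudget : 3 / (2 * π * d ^ 4) * TowerRates.wide.Y 0 * ∫ x, ‖W x‖ ^ 2 < m) :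
    LevelZeroData (U₁ + fun x => W (x - c)) (‖c‖ + R) := by
  have hd : 0 < d := lt_of_lt_of_le (by rw [Host.wide_N_zero]; norm_num) hdN
  have hρ : ρ₁ ≤ ‖c‖ + R := by linarith
  refine h₁.add_far (contDiff_translate c hW) (isDivFree_translate c hdivW)
    (tsupport_translate_subset c hWsupp) hρ
    (far_of_translate c hWsupp hc) hdN (fun x => hWlt (x - c)) hm ?_
  rwa [integral_norm_sq_translate c]

/-- **TOLERANT SLOT, translated amplifier**: a tolerant carrier at push `c'` plus `W(· − c)` with
`1/N₀ ≤ d`, `ρ₁ + d + R < ‖c‖` and `(3/(2πd⁴)) ∫‖W‖² ≤ (c₄ − c') Y₀ / 8` is a tolerant filler at push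
`c₄` of radius `‖c‖ + R`. [cite: Palasek2026ElementaryModel, §3.3] -/
theorem LevelZeroDataTol.add_translate {c' c₄ : ℝ} (h₁ : LevelZeroDataTol c' U₁ ρ₁)
    (hbudget : 3 / (2 * π * d ^ 4) * ∫ x, ‖W x‖ ^ 2 ≤ (c₄ - c') * TowerRates.wide.Y 0 / 8) :
    LevelZeroDataTol c₄ (U₁ + fun x => W (x - c)) (‖c‖ + R) := by
  have hd : 0 < d := lt_of_lt_of_le (by rw [Host.wide_N_zero]; norm_num) hdN
  have hρ : ρ₁ ≤ ‖c‖ + R := by linarith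
  refine h₁.add_far (contDiff_translate c hW) (isDivFree_translate c hdivW)
    (tsupport_translate_subset c hWsupp) hρ
    (far_of_translate c hWsupp hc) hdN (fun x => hWlt (x - c)) ?_
  rwa [integral_norm_sq_translate c]

end Slots

/-! ## §3 Far enough is always enough -/

section Exists

variable {U₁ W : EuclideanSpace ℝ (Fin 3) → EuclideanSpace ℝ (Fin 3)} {ρ₁ R : ℝ}
  (hW : ContDiff ℝ ∞ W) (hdivW : VectorCalculus.IsDivFree W) (hWsupp : tsupport W ⊆ closedBall 0 R)
  (hWlt : ∀ x, ‖W x‖ < TowerRates.wide.Y 0) (hR : 0 ≤ R)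

include hW hdivW hWsupp hWlt hR

omit hW hdivW hWsupp hWlt hR in
/-- A distance making the energy × `d⁻⁴` budget smaller than any prescribed `m > 0`: for
`d ≥ max (1/N₀) (1 + 3 Y₀ E / (2π m))`, `(3/(2πd⁴)) Y₀ E < m` (`E ≥ 0`). [folklore] -/
theorem budget_lt_of_le {E m d : ℝ} (hE : 0 ≤ E) (hm : 0 < m)
    (hd : max (1 / TowerRates.wide.N 0) (1 + 3 * TowerRates.wide.Y 0 * E / (2 * π * m)) ≤ d) :
    3 / (2 * π * d ^ 4) * TowerRates.wide.Y 0 * E < m := by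
  have hY := Host.wide_Y_zero_pos
  have hd1 : 1 + 3 * TowerRates.wide.Y 0 * E / (2 * π * m) ≤ d := (le_max_right _ _).trans hd
  have hq : 0 ≤ 3 * TowerRates.wide.Y 0 * E / (2 * π * m) := by positivity
  have hd1' : 1 ≤ d := by linarith
  have hdpos : 0 < d := by linarith
  -- `d⁴ ≥ d`
  have hd4 : d ≤ d ^ 4 := by
    calc d = d * 1 := (mul_one d).symm
      _ ≤ d * d ^ 3 := by
          apply mul_le_mul_of_nonneg_left _ hdpos.le
          exact one_le_pow₀ hd1'
      _ = d ^ 4 := by ring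
  -- `(3/(2π d)) Y₀ E < m` since `d > 3 Y₀ E/(2π m)`
  have hlt : 3 * TowerRates.wide.Y 0 * E < 2 * π * m * d := by
    have h' : 3 * TowerRates.wide.Y 0 * E / (2 * π * m) < d := by linarith
    rw [div_lt_iff₀ (by positivity)] at h'
    linarith
  calc 3 / (2 * π * d ^ 4) * TowerRates.wide.Y 0 * E
      ≤ 3 / (2 * π * d) * TowerRates.wide.Y 0 * E := by gcongr
    _ = 3 * TowerRates.wide.Y 0 * E / (2 * π * d) := by ring
    _ < m := by rw [div_lt_iff₀ (by positivity)]; linarith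

/-- **EVERY AMPLIFIER, FAR ENOUGH, KEEPS A STRICT CARRIER STRICT.** For a strict-slot carrier `U₁` and
ANY smooth divergence-free `W` with `tsupport W ⊆ B̄(0, R)` and speed `< Y₀`, there is `r₀` such that
`U₁ + W(· − c)` fills the STRICT slot `LevelZeroData · (‖c‖ + R)` for every `‖c‖ ≥ r₀` (the carrier's
positive `rate`, GermHost V, absorbs the energy × `d⁻⁴` push of `W`). [cite: Palasek2026ElementaryModel, §3.3] -/
theorem LevelZeroData.exists_add_translate (h₁ : LevelZeroData U₁ ρ₁) :
    ∃ r₀ : ℝ, ∀ c : EuclideanSpace ℝ (Fin 3), r₀ ≤ ‖c‖ →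
      LevelZeroData (U₁ + fun x => W (x - c)) (‖c‖ + R) := by
  set E := ∫ x, ‖W x‖ ^ 2 with hE
  have hE0 : 0 ≤ E := integral_nonneg fun x => by positivity
  set d := max (1 / TowerRates.wide.N 0) (1 + 3 * TowerRates.wide.Y 0 * E / (2 * π * h₁.rate))
    with hd
  refine ⟨ρ₁ + d + R + 1, fun c hc => ?_⟩
  exact h₁.add_translate hW hdivW hWsupp hWlt hR (le_max_left _ _) (by linarith)
    (fun _ hx => h₁.rate_le hx) (budget_lt_of_le hE0 h₁.rate_pos le_rfl)

/-- **… and every weak carrier tolerant**: for a weak-slot carrier, ANY such `W` and ANY push `c₄ > 0`,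
`U₁ + W(· − c)` fills the tolerant slot `LevelZeroDataTol c₄ · (‖c‖ + R)` for every `‖c‖ ≥ r₀`.
[cite: Palasek2026ElementaryModel, §3.3] -/
theorem LevelZeroDataWeak.exists_add_translate (h₁ : LevelZeroDataWeak U₁ ρ₁) {c₄ : ℝ} (hc₄ : 0 < c₄) :
    ∃ r₀ : ℝ, ∀ c : EuclideanSpace ℝ (Fin 3), r₀ ≤ ‖c‖ →
      LevelZeroDataTol c₄ (U₁ + fun x => W (x - c)) (‖c‖ + R) := by
  have hY := Host.wide_Y_zero_pos
  set E := ∫ x, ‖W x‖ ^ 2 with hE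
  have hE0 : 0 ≤ E := integral_nonneg fun x => by positivity
  -- budget target: `(3/(2πd⁴)) E ≤ (c₄ − c₄/2) Y₀/8`, i.e. `(3/(2πd⁴)) Y₀ E < m := c₄ Y₀²/16` suffices
  set m := c₄ * TowerRates.wide.Y 0 ^ 2 / 16 with hm
  have hm0 : 0 < m := by positivity
  set d := max (1 / TowerRates.wide.N 0) (1 + 3 * TowerRates.wide.Y 0 * E / (2 * π * m)) with hd
  refine ⟨ρ₁ + d + R + 1, fun c hc => ?_⟩
  have hlt := budget_lt_of_le hE0 hm0 (le_refl d)
  have hb : 3 / (2 * π * d ^ 4) * E ≤ (c₄ - c₄ / 2) * TowerRates.wide.Y 0 / 8 := by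
    -- divide `(3/(2πd⁴)) Y₀ E < c₄ Y₀²/16` by `Y₀ > 0`
    have h1 : 3 / (2 * π * d ^ 4) * E * TowerRates.wide.Y 0 ≤
        (c₄ - c₄ / 2) * TowerRates.wide.Y 0 / 8 * TowerRates.wide.Y 0 := by
      have : (c₄ - c₄ / 2) * TowerRates.wide.Y 0 / 8 * TowerRates.wide.Y 0 = m := by rw [hm]; ring
      rw [this]
      linarith
    exact le_of_mul_le_mul_right h1 hY
  exact (h₁.tol (half_pos hc₄)).add_translate hW hdivW hWsupp hWlt hR (le_max_left _ _) (by linarith) hb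

end Exists

end Summit.NavierStokesRegularity.FluidComputer.PalasekTowerClayBridge.Germ

end
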